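import Summits.Langlands.Langlands.Theses.ParityBlindBianchi

/-!
# `QuadraticBaseChangeGL2` (stmt-Langlands-16812): the inert witness of clause (a) is "trace ≠ 0"

Negative-side lemmas (crux disprover `cdisprove-stmt-Langlands-16812`, 2026-08-17; supports
stmt-Langlands-16812; tightness of the load-bearing hypothesis of clause (a)).

Clause (a) of the crux (Arthur–Clozel 1989, Ch. 3 Thm 4.2 (a) at `n = 2`: cuspidal base change
along a quadratic `E/F`) asks for ONE place `v` of `F` inert in `E` where `π` has a Satake parameter
`α` with `∀ ζ : ℂ, IsPrimitiveRoot ζ (finrank F E) → α.map (ζ * ·) ≠ α`, the unramified shadow of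
`π ≇ π ⊗ η_{E/F}`.  With `finrank F E = 2` the only such `ζ` is `-1`
(`isPrimitiveRoot_two_iff_eq_neg_one`), and for a rank-two parameter the condition is EXACTLY
`α.sum ≠ 0`, i.e. a non-zero Hecke eigenvalue `a_v = q_v^{1/2} α.sum`:

* `inertWitness_of_sum_ne_zero` — usable direction, any multiset: `α.sum ≠ 0` is a witness;
* `etaSymmetric_of_sum_eq_zero` — TIGHTNESS: if `card α = 2` and `α.sum = 0` then `α = {a, -a}` is
  `η`-symmetric (`α.map ((-1) * ·) = α`), so at a trace-zero inert place the unramified datum of `π`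
  is that of `π ⊗ η_{E/F}` and cannot serve; the hypothesis admits no place-wise weakening;
* `inertWitness_iff_sum_ne_zero` (and the `finrank` form `…_of_finrank_eq_two`) — the equivalence.
-/

noncomputable section

set_option linter.dupNamespace false -- `Summit.Langlands.Langlands` is the mandated namespace (D-0017)

namespace Summit.Langlands.Langlands.Theorems.QuadraticBaseChangeGL2.Negative

/-- In `ℂ` the primitive square roots of unity are exactly `-1`: the quantifier
`∀ ζ, IsPrimitiveRoot ζ 2 → …` of clause (a) hides neither vacuity nor extra generality. [folklore] -/
theorem isPrimitiveRoot_two_iff_eq_neg_one (ζ : ℂ) : IsPrimitiveRoot ζ 2 ↔ ζ = -1 := by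
  refine ⟨fun h => h.eq_neg_one_of_two_right, ?_⟩
  rintro rfl
  exact IsPrimitiveRoot.neg_one 0 (by norm_num)

/-- `α.map ((-1) * ·)` has sum `-α.sum`. [folklore] -/
theorem sum_map_neg_one_mul (α : Multiset ℂ) : (α.map ((-1 : ℂ) * ·)).sum = -α.sum := by
  rw [Multiset.sum_map_mul_left, Multiset.map_id']
  ring

/-- **Non-zero trace is an inert witness** (any multiset): if `α.sum ≠ 0` then `α ≠ ζ • α` for the
primitive square root of unity `ζ = -1`, i.e. `α` is not `η`-symmetric.  This is the form in which
consumers meet the hypothesis of clause (a): `a_v(π) ≠ 0` at one place `v` inert in `E` where `π` is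
unramified. [folklore] -/
theorem inertWitness_of_sum_ne_zero {α : Multiset ℂ} (hα : α.sum ≠ 0) :
    ∀ ζ : ℂ, IsPrimitiveRoot ζ 2 → α.map (ζ * ·) ≠ α := by
  intro ζ hζ heq
  rw [(isPrimitiveRoot_two_iff_eq_neg_one ζ).1 hζ] at heq
  have hs := congrArg Multiset.sum heq
  rw [sum_map_neg_one_mul] at hs
  apply hα
  linear_combination (-(1 : ℂ) / 2) * hs

/-- **Tightness in rank two: zero trace kills the witness.**  If `card α = 2` and `α.sum = 0` then
`α = {a, -a}` and `α.map ((-1) * ·) = α`: the Satake parameter IS `η`-symmetric, the unramified data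
of `π` and `π ⊗ η_{E/F}` agree at that inert place, and the witness clause fails there. [folklore] -/
theorem etaSymmetric_of_sum_eq_zero {α : Multiset ℂ} (h2 : Multiset.card α = 2)
    (h0 : α.sum = 0) : α.map ((-1 : ℂ) * ·) = α := by
  obtain ⟨a, b, rfl⟩ := Multiset.card_eq_two.1 h2
  have hb : b = -a := by
    simp only [Multiset.insert_eq_cons, Multiset.sum_cons, Multiset.sum_singleton] at h0
    linear_combination h0
  subst hb
  simp only [Multiset.insert_eq_cons, Multiset.map_cons, Multiset.map_singleton, neg_mul, one_mul,
    neg_neg]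
  exact Multiset.pair_comm (-a) a

/-- **The inert witness of clause (a) is exactly `trace ≠ 0`** for a rank-two Satake parameter
(`card α = 2`, which every `HasSatakeParamAt` datum of `GL₂` has, `HasSatakeParamAt.card_eq`).
[folklore] -/
theorem inertWitness_iff_sum_ne_zero {α : Multiset ℂ} (h2 : Multiset.card α = 2) :
    (∀ ζ : ℂ, IsPrimitiveRoot ζ 2 → α.map (ζ * ·) ≠ α) ↔ α.sum ≠ 0 := by
  refine ⟨fun h h0 => ?_, inertWitness_of_sum_ne_zero⟩
  exact h (-1) ((isPrimitiveRoot_two_iff_eq_neg_one _).2 rfl) (etaSymmetric_of_sum_eq_zero h2 h0)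

/-- The witness clause of (a) read through `Module.finrank F E = 2`, in the trace form.
[folklore] -/
theorem inertWitness_iff_sum_ne_zero_of_finrank_eq_two {F E : Type*} [Field F] [Field E]
    [Algebra F E] (hFE : Module.finrank F E = 2) {α : Multiset ℂ} (h2 : Multiset.card α = 2) :
    (∀ ζ : ℂ, IsPrimitiveRoot ζ (Module.finrank F E) → α.map (ζ * ·) ≠ α) ↔ α.sum ≠ 0 := by
  rw [hFE]; exact inertWitness_iff_sum_ne_zero h2

/-- Consumer form: a rank-two Satake parameter with non-zero trace at a place of `F` inert in the
quadratic `E` discharges the witness conjunct of clause (a) as typed (`IsPrimitiveRoot ζ (finrank F E)`).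
[folklore] -/
theorem inertWitness_of_sum_ne_zero_of_finrank_eq_two {F E : Type*} [Field F] [Field E]
    [Algebra F E] (hFE : Module.finrank F E = 2) {α : Multiset ℂ} (hα : α.sum ≠ 0) :
    ∀ ζ : ℂ, IsPrimitiveRoot ζ (Module.finrank F E) → α.map (ζ * ·) ≠ α := by
  rw [hFE]; exact inertWitness_of_sum_ne_zero hα

end Summit.Langlands.Langlands.Theorems.QuadraticBaseChangeGL2.Negative

end
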